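import Summits.BirchSwinnertonDyer.BirchSwinnertonDyer.Theorems.GenusKolyvaginAtTwoOffCutResidualAtTwoRVisibleDeepSocleSOC
import Summits.BirchSwinnertonDyer.BirchSwinnertonDyer.Theorems.GenusKolyvaginAtTwoShaCardDvdPowAtTwoRSelVisibleHabitat
import Summits.BirchSwinnertonDyer.BirchSwinnertonDyer.Theorems.GenusKolyvaginAtTwoOffCutResidualAtTwoRSocleSelectionRealVisibleDescent
import HarnessLib

/-!
# Route `GenusKolyvaginAtTwo`, residual `OffCutResidualAtTwoR` (stmt-BirchSwinnertonDyer-31767), LINE 28 «visible_deep_socle» STUB N2, conjunct (HL) —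
# THE HEEGNER LINE'S SOCLE IS THE LIFT OF THE `ℓ₀`-TRIVIAL SELMER CLASS, and (HL) REDUCED to the non-phantomness of that ONE class over `K`

LEAD seat `bsd-line-gk2-p1` g25 (cell `bsd-f1-sign2`), `--supports stmt-BirchSwinnertonDyer-31767 --as helper`; sequel of `…VisibleDeepSocleSOC`.  THEOREMS ONLY
(no definition, no named fact, no `sorry`).  **BSD is NOT proved by this file; `OffCutResidualAtTwoR`, K4Neg and crux 23491 are NOT proved; N2's (HL) is NOT
proved — it is REDUCED to a `2`-descent-free statement about one class of `H¹(ℚ, E[2])`.**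

* **`exists_doorTrivial_lift_eq_heegnerSocle`** (N2's binders VERBATIM): for `M ≥ M₀ + 1` there is a NON-ZERO `ℓ₀`-TRIVIAL class `u ∈ Sel₂(E)` (the
  capitulating class `s_y`, `res_K u = κ₂(y_K/2^{M₀})`) with `2^{M-M₀-1} • ι_M c_M(1) = ι_{1→M+1} res_K u ≠ 0`, `2 • (ι_{1→M+1} res_K u) = 0`: the socle of the
  level-raised Heegner line `⟨ι_M c_M(1)⟩ ⊂ H¹(K, E[2^{M+1}])` IS the lift of `res_K u`.
* **`heegnerLift_of_doorTrivial_nonPhantom`** (N2's binders VERBATIM + ONE hypothesis, conclusion = N2's (HL) VERBATIM): IF for every `M ≥ M₀ + 1` and every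
  non-zero `ℓ₀`-trivial `u ∈ Sel₂(E)` the lift `ι_{1→M+1} res_K u` is NOT phantom over `K` (not killed by every `ρ ∈ Γ_{K(E[2^{M+1}])}`), THEN (HL): no
  non-zero multiple of `ι_M c_M(1)` is phantom, at every level `M` (for `M ≤ M₀`, `ι_M c_M(1) = 2^{M₀} ι κ_{2^M}(Q₀) = 0`; for `M ≥ M₀ + 1` a phantom multiple is
  `2`-torsion (Lawson–Wuthrich on the habitat), hence `0` or the socle).  So STUB N2a = «VIS ⟹ the lift of the `ℓ₀`-trivial line is visible over `K` at every
  level» — pure Galois cohomology of `ℚ(E[2^∞])`, no Heegner point, no twin.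
BSD is NOT proved by any of this.

References: [GrossLMS1991] §4 (4.4), §5 (5.1); [McCallumLMS1991] §4 (6), Lemma 4.6, §5 Lemma 5.1; [LawsonWuthrich2016] §7.1, Lemma 3; [MazurRubin2010] Prop. 3.3.
-/

set_option autoImplicit false
-- the Theorems namespace of this sub repeats the summit name by design (D-0017 nested layout)
set_option linter.dupNamespace false

noncomputable section

open scoped Classical

namespace Summit.BirchSwinnertonDyer.BirchSwinnertonDyer.Theorems.GenusExact.PlusDescent.SocleSelection

open WeierstrassCurve NumberField IsDedekindDomain Field
open Literature.NumberTheory.EllipticCurves Literature.NumberTheory.GaloisRepresentations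
open Summit.BirchSwinnertonDyer.Rank1Residual.F1Sign2 (NoRationalTwoTorsion IsQuadraticCharacterOf)
open Summit.BirchSwinnertonDyer.Rank1Residual.F1Sign2.TranspositionDoor (TranspAdmissible)
open Summit.BirchSwinnertonDyer.BirchSwinnertonDyer.Theorems.GenusKolyArch
open Summit.BirchSwinnertonDyer.BirchSwinnertonDyer.Theorems.GenusSupplyNarrow.KFourPosCell
open Summit.BirchSwinnertonDyer.BirchSwinnertonDyer.Theses.GenusKolyvaginAtTwo (MultPublishedInputsAtTwo)
open Literature.NumberTheory.EllipticCurves.ModularForms Literature.NumberTheory.EllipticCurves.KolyvaginCocycle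

universe u

section HL

/-- `E(K)[2] = 0` (in `(2 : ℤ) •` form) for `ρ̄_{E,2}` onto and `K` imaginary quadratic. [cite: DokchitserDokchitserMathZ2012, Theorem (1)] -/
private theorem two_zsmul_eq_zero_imp (W : WeierstrassCurve ℚ) [W.IsElliptic] {K : Type} [Field K] [NumberField K]
    (hρ : W.HasSurjectiveModNGaloisRep 2) (hK : IsImaginaryQuadratic K) (T : (W.baseChange K).toAffine.Point) (hT2 : (2 : ℤ) • T = 0) :
    T = 0 := by
  have hmem : T ∈ AddSubgroup.torsionBy (W.baseChange K).toAffine.Point (2 : ℤ) := (Submodule.mem_torsionBy_iff _ T).mpr hT2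
  rw [torsionBy_two_baseChange_eq_bot_of_hasSurjectiveModNGaloisRep_two_of_isImaginaryQuadratic W hρ K hK] at hmem
  exact AddSubgroup.mem_bot.mp hmem

/-- Socle uniqueness in a cyclic `2`-group: if `2^k • w` has order exactly `2` (`w` of `2`-power order), every `m • w` killed by `2` is `0`
or `2^k • w`.  (Adapted from the LINE 27 skeleton's `zsmul_eq_zero_or_eq_socle`, bsd-idea-1 g25, kernel-checked there.) [folklore] -/
private theorem zsmul_eq_zero_or_eq_socle {A : Type*} [AddCommGroup A] {n : ℕ} (w : A)
    (hw : ((2 ^ n : ℕ) : ℤ) • w = 0) (k : ℕ) (hne : ((2 ^ k : ℕ) : ℤ) • w ≠ 0)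
    (h2 : (2 : ℤ) • (((2 ^ k : ℕ) : ℤ) • w) = 0) (m : ℤ) (hm : (2 : ℤ) • (m • w) = 0) :
    m • w = 0 ∨ m • w = ((2 ^ k : ℕ) : ℤ) • w := by
  have ho : addOrderOf w ∣ 2 ^ n := by
    rw [natCast_zsmul] at hw
    exact addOrderOf_dvd_iff_nsmul_eq_zero.2 hw
  have hk : ¬ addOrderOf w ∣ 2 ^ k := by
    intro h
    apply hne
    rw [natCast_zsmul]
    exact addOrderOf_dvd_iff_nsmul_eq_zero.1 h
  have hk1 : addOrderOf w ∣ 2 ^ (k + 1) := by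
    apply addOrderOf_dvd_iff_nsmul_eq_zero.2
    have h2' : (2 : ℕ) • (((2 ^ k : ℕ) : ℤ) • w) = 0 := by
      rw [two_nsmul]; rw [two_zsmul] at h2; exact h2
    rw [natCast_zsmul] at h2'
    rw [pow_succ', mul_smul]
    exact h2'
  obtain ⟨e, -, hoe⟩ := (Nat.dvd_prime_pow Nat.prime_two).1 ho
  rw [hoe] at hk hk1
  have he1 : e ≤ k + 1 := (Nat.pow_dvd_pow_iff_le_right (by norm_num)).1 hk1
  have he2 : ¬ e ≤ k := fun h ↦ hk ((Nat.pow_dvd_pow_iff_le_right (by norm_num)).2 h)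
  have he : e = k + 1 := by omega
  have hdvd : ((addOrderOf w : ℕ) : ℤ) ∣ 2 * m := by
    apply addOrderOf_dvd_iff_zsmul_eq_zero.2
    rw [mul_smul]; exact hm
  rw [hoe, he] at hdvd
  push_cast at hdvd
  rw [pow_succ'] at hdvd
  obtain ⟨m', rfl⟩ := (mul_dvd_mul_iff_left (two_ne_zero : (2 : ℤ) ≠ 0)).1 hdvd
  have hσ : ((2 ^ k : ℕ) : ℤ) • w + ((2 ^ k : ℕ) : ℤ) • w = 0 := by
    rw [← two_zsmul]; exact h2
  have hmw : (2 ^ k * m') • w = m' • (((2 ^ k : ℕ) : ℤ) • w) := by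
    push_cast
    rw [mul_comm, mul_smul]
  rw [hmw]
  rcases Int.even_or_odd m' with ⟨r, hr⟩ | ⟨r, hr⟩
  · left
    rw [hr, add_smul, ← smul_add, hσ, smul_zero]
  · right
    rw [hr, add_smul, one_smul, mul_smul, two_zsmul, ← smul_add, hσ, smul_zero, zero_add]

/-- `ι ∘ ι = ι` for the change-of-level maps `torsionH1OfDvd` (functoriality in compatible pairs). [cite: SerreGaloisCohomology1997, I.§2.4] -/
private theorem torsionH1OfDvd_torsionH1OfDvd {K₀ : Type u} [Field K₀] (V : WeierstrassCurve K₀) {d m n : ℤ}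
    (h₁ : d ∣ m) (h₂ : m ∣ n) (x : galH1Torsion V d) :
    torsionH1OfDvd V h₂ (torsionH1OfDvd V h₁ x) = torsionH1OfDvd V (h₁.trans h₂) x := by
  unfold torsionH1OfDvd
  rw [resH1Hom_resH1Hom]
  exact congrFun (congrArg DFunLike.coe (resH1Hom_congr (by ext; rfl) (by ext; rfl) _ _)) x

/-- **`c_M(1) = 0` BELOW THE DEPTH**: if `P₀ = 2^{M₀} Q₀` in `E(K)` (`P₀` the descended Heegner point) then `c_M(1) = κ_{2^M}(P₀) = 2^{M₀-M}·(2^M κ_{2^M}(Q₀)) = 0`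
for every `M ≤ M₀`.  BSD is NOT proved by this. [cite: GrossLMS1991, §4 (4.4)] [cite: McCallumLMS1991, §4 (6)] -/
theorem kolyvaginClass_one_eq_zero_of_le (W : WeierstrassCurve ℚ) [W.IsElliptic] [W.IsGloballyMinimal] [NeZero (W.conductorNorm ℤ)]
    {K : Type} [Field K] [NumberField K] (hIQ : IsImaginaryQuadratic K)
    (hodd : Odd (discr K)) (hHe : SatisfiesHeegnerHypothesis (W.conductorNorm ℤ) K) (hsurj : W.HasSurjectiveModNGaloisRep ((2 : ℤ) ^ 1))
    {Dt : ModularParametrizationData W (W.conductorNorm ℤ)} {β : ℤ} {ι : K →+* ℂ} (d₁ : KolyvaginHeegnerData Dt β ι 1)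
    {P₀ Q₀ : (W.baseChange K).toAffine.Point}
    (hP₀ : WeierstrassCurve.Affine.Point.map (W' := W) (algebraMap K (ringClassField K ι 1)).toRatAlgHom P₀ = d₁.derivedPoint)
    {M₀ M : ℕ} (hQ₀ : ((2 ^ M₀ : ℕ) : ℤ) • Q₀ = P₀) (hM : M ≤ M₀) :
    d₁.kolyvaginClass Nat.prime_two M = 0 := by
  haveI : (W.baseChange K).IsElliptic := inferInstanceAs (W.map (algebraMap ℚ K)).IsElliptic
  have hc1 := GenusExact.VisiblePairAtTwo.kolyvaginClass_one_two_eq_kummerMapTorsion W K hIQ hodd hHe hsurj M d₁ P₀ hP₀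
  have hsplit : ((2 ^ M₀ : ℕ) : ℤ) = ((2 ^ (M₀ - M) : ℕ) : ℤ) * ((2 ^ M : ℕ) : ℤ) := by
    push_cast; rw [← pow_add]; congr 1; omega
  rw [hc1, ← hQ₀, map_zsmul, hsplit, mul_smul]
  have h0 := zsmul_galH1Torsion_eq_zero (W.baseChange K) ((2 ^ M : ℕ) : ℤ)
    (kummerMapTorsion (W.baseChange K) ((2 ^ M : ℕ) : ℤ)
      ((W.baseChange K).zsmul_geomPoints_surjective_of_charZero (by exact_mod_cast pow_ne_zero M two_ne_zero)) Q₀)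
  rw [h0]
  exact zsmul_zero _

/-- **THE HEEGNER LINE'S SOCLE IS THE LIFT OF THE `ℓ₀`-TRIVIAL SELMER CLASS** (N2's binders VERBATIM; `Δ_E < 0`).  For `M ≥ M₀ + 1`: a non-zero
`ℓ₀`-trivial `u ∈ Sel₂(E)` with `2^{M-M₀-1} • ι_M c_M(1) = ι_{1→M+1} res_K u ≠ 0` and `2 • ι_{1→M+1} res_K u = 0`.  `u` is the capitulating class of the
twin's Selmer group `T = {0, s_y}` (`…TwistSelmerPair`), `ℓ₀`-trivial by `doorTrivial_iff_mem_primeTwist_selmerGroup` (frame transposition-admissible by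
`transpAdmissible_of_deepPrimeFrame`); the identity is `pow_zsmul_kolyvaginClass_one_eq_torsionH1OfDvd_kummer`.  PRINT used: `MultPublishedInputsAtTwo` (ranks
`0 + 1`).  BSD is NOT proved by this. [cite: GrossLMS1991, §4 (4.4), §5 (5.1)] [cite: McCallumLMS1991, §4 Lemma 4.6, §5 Lemma 5.1] [cite: MazurRubin2010, Prop. 3.3] -/
theorem exists_doorTrivial_lift_eq_heegnerSocle :
    ∀ (W : WeierstrassCurve ℚ) [W.IsElliptic] [W.IsGloballyMinimal] [NeZero (W.conductorNorm ℤ)],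
      W.analyticRank = 0 → (∀ n : ℕ, 0 < n → W.HasSurjectiveModNGaloisRep ((2 : ℤ) ^ n)) → Odd W.tamagawaProduct → W.Δ < 0 →
      ∀ (K : Type) [Field K] [NumberField K], IsImaginaryQuadratic K → Odd (NumberField.discr K) → NumberField.discr K ≠ -3 →
        SatisfiesHeegnerHypothesis (W.conductorNorm ℤ) K →
        ¬ IsSquare ((NumberField.discr K : ℚ) * -|W.Δ|) → ¬ IsSquare ((NumberField.discr K : ℚ) * (-(2 * |W.Δ|))) →
      ∀ (ℓ₀ : ℕ) (v : HeightOneSpectrum (𝓞 ℚ)), ℓ₀.Prime → NumberField.discr K = -(ℓ₀ : ℤ) →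
        ((Ideal.span {(2 : ℤ)}).primesOver (𝓞 K)).ncard = 2 → ((ℓ₀ : ℕ) : 𝓞 ℚ) ∈ v.asIdeal →
        (∀ c : galH1Torsion W 2, c ∈ W.selmerGroup 2 → c ∈ W.torsionLocalKer (v.adicCompletion ℚ) 2 →
            (∀ (h₁₂ : (2 : ℤ) ∣ ((2 ^ 2 : ℕ) : ℤ)), ∀ ρ ∈ torsionFixing W ((2 ^ 2 : ℕ) : ℤ),
              h1Eval W ((2 ^ 2 : ℕ) : ℤ) (torsionH1OfDvd W h₁₂ c) ρ = 0) → c = 0) →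
      ∀ (Dt : ModularParametrizationData W (W.conductorNorm ℤ)),
        (∀ z ∈ Dt.L.lattice, ∃ w ∈ periodLattice Dt.f, z = (Dt.c : ℂ) * w) → Odd Dt.c →
      ∀ (β : ℤ) (ι : K →+* ℂ) (d₁ : KolyvaginHeegnerData Dt β ι 1), ¬ IsOfFinAddOrder d₁.derivedPoint →
      ∀ (M₀ : ℕ), (∃ Q : (W.baseChange (ringClassField K ι 1)).toAffine.Point, ((2 ^ M₀ : ℕ) : ℤ) • Q = d₁.derivedPoint) →
        (¬ ∃ Q : (W.baseChange (ringClassField K ι 1)).toAffine.Point, ((2 ^ (M₀ + 1) : ℕ) : ℤ) • Q = d₁.derivedPoint) →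
      ∀ (Wd : WeierstrassCurve ℚ) [Wd.IsElliptic] [Wd.IsGloballyMinimal],
        (∃ C : WeierstrassCurve.VariableChange ℚ, C • W.quadraticTwist (NumberField.discr K : ℚ) = Wd) →
        Wd.analyticRank = 1 → Nat.card (Wd.selmerGroup 2) = 2 → padicValNat 2 Wd.tamagawaProduct ≤ 1 →
      Nat.card (W.selmerGroup 2) = 4 → MultPublishedInputsAtTwo →
      ∀ (M : ℕ), M₀ + 1 ≤ M → ∀ (hdvd : ((2 ^ M : ℕ) : ℤ) ∣ ((2 ^ (M + 1) : ℕ) : ℤ)) (h1 : (2 : ℤ) ∣ ((2 ^ (M + 1) : ℕ) : ℤ)),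
        ∃ u ∈ W.selmerGroup 2, u ≠ 0 ∧ u ∈ W.torsionLocalKer (v.adicCompletion ℚ) 2 ∧
          ((2 ^ (M - (M₀ + 1)) : ℕ) : ℤ) • torsionH1OfDvd (W.baseChange K) hdvd (d₁.kolyvaginClass Nat.prime_two M) =
            torsionH1OfDvd (W.baseChange K) h1 (resTorsion W K 2 u) ∧
          torsionH1OfDvd (W.baseChange K) h1 (resTorsion W K 2 u) ≠ 0 ∧
          (2 : ℤ) • torsionH1OfDvd (W.baseChange K) h1 (resTorsion W K 2 u) = 0 := by
  intro W _ _ _ hr0 hρ _hTam hneg K _ _ hIQ hodd _h3 hHe hsq1 _hsq2 ℓ₀ v hℓ₀ hdK h2K hv _hVIS Dt _hopt _hc β ι d₁ _hy M₀ hdiv hndiv Wd _ _ hWd hrd hSel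
    _hbudget h4 hGZK M hM hdvd h1
  haveI : (W.baseChange K).IsElliptic := inferInstanceAs (W.map (algebraMap ℚ K)).IsElliptic
  have h2 : Module.finrank ℚ K = 2 := hIQ.1
  obtain ⟨θ, hθ, hθc⟩ := exists_sq_eq_discr_not_mem_range K h2
  have hsurj1 : W.HasSurjectiveModNGaloisRep ((2 : ℤ) ^ 1) := hρ 1 one_pos
  have hρ2 : W.HasSurjectiveModNGaloisRep 2 := by simpa using hsurj1
  have hT : NoRationalTwoTorsion W := GenusKolyTwin.noRationalTwoTorsion_of_hasSurjectiveModNGaloisRep W hsurj1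
  obtain ⟨Cd, hCd⟩ := hWd
  obtain ⟨χ, hχ⟩ := GenusKolyTransp.quadraticCharacterExists_holds (discr K)
  -- ranks from print: `rank E(ℚ) = 0`, `rank Wd(ℚ) = 1`, hence `rank E(K) = 1`
  have hrkW : W.mordellWeilRank = 0 := by rw [(hGZK W (by rw [hr0]; exact zero_le_one)).1, hr0]
  have hrkWd : Wd.mordellWeilRank = 1 := by rw [(hGZK Wd (by rw [hrd])).1, hrd]
  have hrkTw : (W.quadraticTwist (discr K : ℚ)).mordellWeilRank = 1 := by
    rw [← mordellWeilRank_variableChange_holds (W.quadraticTwist (discr K : ℚ)) Cd, hCd, hrkWd]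
  have hrkK : (W.baseChange K).mordellWeilRank = 1 := by
    rw [mordellWeilRank_baseChange_eq_add_of_sq_eq W K h2 hθ hθc, hrkW, hrkTw]
  have hbotK : AddSubgroup.torsionBy (W.baseChange K).toAffine.Point (2 : ℤ) = ⊥ :=
    torsionBy_two_baseChange_eq_bot_of_hasSurjectiveModNGaloisRep_two_of_isImaginaryQuadratic W hρ2 K hIQ
  have h2Kt := two_zsmul_eq_zero_imp W hρ2 hIQ
  -- the frame is transposition-admissible at `ℓ₀`; `P₀ ∈ E(K)` under `P(1)`, `Q₀ = P₀/2^{M₀} ∉ 2E(K)` (McCallum 5.1)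
  have hadm : TranspAdmissible W (discr K) ℓ₀ := transpAdmissible_of_deepPrimeFrame W hIQ hodd hHe hneg hℓ₀ hdK h2K
  have hsqΔ : ¬ IsSquare ((NumberField.discr K : ℚ) * W.Δ) := by
    rwa [show -|W.Δ| = W.Δ by rw [abs_of_neg hneg, neg_neg]] at hsq1
  have htors1 : ∀ T : (W.baseChange (ringClassField K ι 1)).toAffine.Point, (2 : ℤ) • T = 0 → T = 0 := by
    intro T hT
    have h := GenusExact.torsionBy_two_ringClassField_eq_bot W hIQ ι one_ne_zero hρ2 hsqΔ
    have hT' : T ∈ AddSubgroup.torsionBy (W.baseChange (ringClassField K ι 1)).toAffine.Point ((2 : ℕ) : ℤ) :=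
      (Submodule.mem_torsionBy_iff _ T).mpr (by exact_mod_cast hT)
    rw [h] at hT'
    exact (AddSubgroup.mem_bot).mp hT'
  obtain ⟨P₀, -, hP₀⟩ := heegnerSystem_exists_isHeegnerPoint_map_eq_derivedPoint_one
    (heegnerPointOfConductor_one_galoisConj_holds (W.conductorNorm ℤ) W K) hIQ hHe d₁
  have hdivK : ∃ Q₀ : (W.baseChange K).toAffine.Point, ((2 ^ M₀ : ℕ) : ℤ) • Q₀ = P₀ := by
    obtain ⟨Q, hQ⟩ := hdiv
    obtain ⟨Q₀, hQ₀⟩ := (McCallum1991.exists_pow_smul_eq_derivedPoint_one_iff hIQ d₁ (p := 2) htors1 hP₀ M₀).mp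
      ⟨Q, by simpa only [Nat.cast_pow, Nat.cast_ofNat] using hQ⟩
    exact ⟨Q₀, by simpa only [Nat.cast_pow, Nat.cast_ofNat] using hQ₀⟩
  have hndivK : ¬ ∃ Q₁ : (W.baseChange K).toAffine.Point, ((2 ^ (M₀ + 1) : ℕ) : ℤ) • Q₁ = P₀ := by
    rintro ⟨Q₁, hQ₁⟩
    refine hndiv ?_
    obtain ⟨Q, hQ⟩ := (McCallum1991.exists_pow_smul_eq_derivedPoint_one_iff hIQ d₁ (p := 2) htors1 hP₀ (M₀ + 1)).mpr
      ⟨Q₁, by simpa only [Nat.cast_pow, Nat.cast_ofNat] using hQ₁⟩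
    exact ⟨Q, by simpa only [Nat.cast_pow, Nat.cast_ofNat] using hQ⟩
  obtain ⟨Q₀, hQ₀⟩ := hdivK
  have hQ₀nd : ¬ ∃ R : (W.baseChange K).toAffine.Point, (2 : ℤ) • R = Q₀ := by
    rintro ⟨R, hR⟩
    refine hndivK ⟨R, ?_⟩
    have h22 : ((2 ^ (M₀ + 1) : ℕ) : ℤ) = ((2 ^ M₀ : ℕ) : ℤ) * 2 := by push_cast; ring
    rw [h22, mul_smul, hR, hQ₀]
  -- the capitulating class `u`: `u ∈ T`, `u ≠ 0`, `res_K u = κ₂(Q₀)`; it is an `ℓ₀`-trivial Selmer class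
  obtain ⟨u, huT, hu0, hresu⟩ := exists_resTorsion_eq_kummer_mem_primeTwist_selmerGroup W (K := K) hT h2 hθ hθc Cd hCd hrkWd hSel hrkK
    h2Kt hQ₀nd hχ
  obtain ⟨huS, huv⟩ := (doorTrivial_iff_mem_primeTwist_selmerGroup W hneg h4 hadm hv Cd hCd hSel hχ u).mpr huT
  have h1' : ((2 : ℕ) : ℤ) ∣ ((2 ^ (M + 1) : ℕ) : ℤ) := h1
  have hheeg := pow_zsmul_kolyvaginClass_one_eq_torsionH1OfDvd_kummer W hIQ hodd hHe hsurj1 d₁ hP₀ hQ₀ hM hdvd h1'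
  refine ⟨u, huS, hu0, huv, ?_, ?_, ?_⟩
  · -- the levels `2` and `((2 : ℕ) : ℤ)` agree definitionally
    change ((2 ^ (M - (M₀ + 1)) : ℕ) : ℤ) • torsionH1OfDvd (W.baseChange K) hdvd (d₁.kolyvaginClass Nat.prime_two M) =
      torsionH1OfDvd (W.baseChange K) h1' (resTorsion W K ((2 : ℕ) : ℤ) u)
    rw [hheeg, hresu]
  · intro h0
    have hbot' : AddSubgroup.torsionBy (W.baseChange K).toAffine.Point ((2 : ℕ) : ℤ) = ⊥ := hbotK
    have h1'' : ((2 ^ 1 : ℕ) : ℤ) ∣ ((2 ^ (M + 1) : ℕ) : ℤ) := by simpa only [pow_one] using h1'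
    have hinj := GenusExact.VisiblePairAtTwo.torsionH1OfDvd_pow_injective (W.baseChange K) (p := 2) hbot' h1''
    apply hu0
    apply GenusExact.EigenClassesFinite.resTorsion_injective_of_noTorsion W K h2 hθ hθc ((2 : ℕ) : ℤ) h2Kt
    rw [map_zero]
    apply hinj
    rw [map_zero]
    exact h0
  · rw [← map_zsmul, show (2 : ℤ) • resTorsion W K 2 u = 0 from zsmul_galH1Torsion_eq_zero (W.baseChange K) _ _, map_zero]

/-- **N2's (HL) REDUCED TO THE VISIBILITY OVER `K` OF ONE LEVEL-2 CLASS** (N2's binders VERBATIM, ONE extra hypothesis, conclusion = N2's (HL) VERBATIM).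
IF for every `M ≥ M₀ + 1` and every non-zero `ℓ₀`-trivial `u ∈ Sel₂(E)` the lift `ι_{1→M+1} res_K u ∈ H¹(K, E[2^{M+1}])` is NOT phantom over `K`, THEN no
non-zero multiple of `ι_M c_M(1)` is phantom, at every level `M`: for `M ≤ M₀`, `c_M(1) = κ_{2^M}(2^{M₀} Q₀) = 0`; for `M ≥ M₀ + 1` a phantom multiple is
`2`-torsion (Lawson–Wuthrich on the habitat), hence `0` or the socle `ι_{1→M+1} res_K u` (`exists_doorTrivial_lift_eq_heegnerSocle`), and the socle is
visible by hypothesis.  BSD is NOT proved by this; the hypothesis (STUB N2a's honest content) is NOT proved here.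
[cite: LawsonWuthrich2016, §7.1, Lemma 3] [cite: McCallumLMS1991, §4 (6), Lemma 4.6] [cite: GrossLMS1991, §4 (4.4)] -/
theorem heegnerLift_of_doorTrivial_nonPhantom :
    ∀ (W : WeierstrassCurve ℚ) [W.IsElliptic] [W.IsGloballyMinimal] [NeZero (W.conductorNorm ℤ)],
      W.analyticRank = 0 → (∀ n : ℕ, 0 < n → W.HasSurjectiveModNGaloisRep ((2 : ℤ) ^ n)) → Odd W.tamagawaProduct → W.Δ < 0 →
      ∀ (K : Type) [Field K] [NumberField K], IsImaginaryQuadratic K → Odd (NumberField.discr K) → NumberField.discr K ≠ -3 →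
        SatisfiesHeegnerHypothesis (W.conductorNorm ℤ) K →
        ¬ IsSquare ((NumberField.discr K : ℚ) * -|W.Δ|) → ¬ IsSquare ((NumberField.discr K : ℚ) * (-(2 * |W.Δ|))) →
      ∀ (ℓ₀ : ℕ) (v : HeightOneSpectrum (𝓞 ℚ)), ℓ₀.Prime → NumberField.discr K = -(ℓ₀ : ℤ) →
        ((Ideal.span {(2 : ℤ)}).primesOver (𝓞 K)).ncard = 2 → ((ℓ₀ : ℕ) : 𝓞 ℚ) ∈ v.asIdeal →
        (∀ c : galH1Torsion W 2, c ∈ W.selmerGroup 2 → c ∈ W.torsionLocalKer (v.adicCompletion ℚ) 2 →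
            (∀ (h₁₂ : (2 : ℤ) ∣ ((2 ^ 2 : ℕ) : ℤ)), ∀ ρ ∈ torsionFixing W ((2 ^ 2 : ℕ) : ℤ),
              h1Eval W ((2 ^ 2 : ℕ) : ℤ) (torsionH1OfDvd W h₁₂ c) ρ = 0) → c = 0) →
      ∀ (Dt : ModularParametrizationData W (W.conductorNorm ℤ)),
        (∀ z ∈ Dt.L.lattice, ∃ w ∈ periodLattice Dt.f, z = (Dt.c : ℂ) * w) → Odd Dt.c →
      ∀ (β : ℤ) (ι : K →+* ℂ) (d₁ : KolyvaginHeegnerData Dt β ι 1), ¬ IsOfFinAddOrder d₁.derivedPoint →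
      ∀ (M₀ : ℕ), (∃ Q : (W.baseChange (ringClassField K ι 1)).toAffine.Point, ((2 ^ M₀ : ℕ) : ℤ) • Q = d₁.derivedPoint) →
        (¬ ∃ Q : (W.baseChange (ringClassField K ι 1)).toAffine.Point, ((2 ^ (M₀ + 1) : ℕ) : ℤ) • Q = d₁.derivedPoint) →
      ∀ (Wd : WeierstrassCurve ℚ) [Wd.IsElliptic] [Wd.IsGloballyMinimal],
        (∃ C : WeierstrassCurve.VariableChange ℚ, C • W.quadraticTwist (NumberField.discr K : ℚ) = Wd) →
        Wd.analyticRank = 1 → Nat.card (Wd.selmerGroup 2) = 2 → padicValNat 2 Wd.tamagawaProduct ≤ 1 →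
      Nat.card (W.selmerGroup 2) = 4 → MultPublishedInputsAtTwo →
      (∀ (M : ℕ), M₀ + 1 ≤ M → ∀ (h1 : (2 : ℤ) ∣ ((2 ^ (M + 1) : ℕ) : ℤ)), ∀ u ∈ W.selmerGroup 2, u ≠ 0 →
          u ∈ W.torsionLocalKer (v.adicCompletion ℚ) 2 →
          ¬ (∀ ρ ∈ torsionFixing (W.baseChange K) ((2 ^ (M + 1) : ℕ) : ℤ),
              h1Eval (W.baseChange K) ((2 ^ (M + 1) : ℕ) : ℤ) (torsionH1OfDvd (W.baseChange K) h1 (resTorsion W K 2 u)) ρ = 0)) →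
      (∀ (M : ℕ) (hdvd : ((2 ^ M : ℕ) : ℤ) ∣ ((2 ^ (M + 1) : ℕ) : ℤ)) (c : ℤ),
          (∀ ρ ∈ torsionFixing (W.baseChange K) ((2 ^ (M + 1) : ℕ) : ℤ), h1Eval (W.baseChange K) ((2 ^ (M + 1) : ℕ) : ℤ)
              (c • torsionH1OfDvd (W.baseChange K) hdvd (d₁.kolyvaginClass Nat.prime_two M)) ρ = 0) →
          c • torsionH1OfDvd (W.baseChange K) hdvd (d₁.kolyvaginClass Nat.prime_two M) = 0) := by
  intro W _ _ _ hr0 hρ hTam hneg K _ _ hIQ hodd h3 hHe hsq1 hsq2 ℓ₀ v hℓ₀ hdK h2K hv hVIS Dt hopt hc β ι d₁ hy M₀ hdiv hndiv Wd _ _ hWd hrd hSel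
    hbudget h4 hGZK hvis M hdvd c hph
  haveI : (W.baseChange K).IsElliptic := inferInstanceAs (W.map (algebraMap ℚ K)).IsElliptic
  have hsurj1 : W.HasSurjectiveModNGaloisRep ((2 : ℤ) ^ 1) := hρ 1 one_pos
  have hρ2 : W.HasSurjectiveModNGaloisRep 2 := by simpa using hsurj1
  -- a phantom multiple is `2`-torsion (Lawson–Wuthrich over `K` on the habitat)
  have htwo := GenusExact.VisiblePairAtTwo.two_zsmul_eq_zero_of_forall_h1Eval_eq_zero_habitat W K (M + 1) hIQ hodd hsq1 hsq2 hρ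
    (c • torsionH1OfDvd (W.baseChange K) hdvd (d₁.kolyvaginClass Nat.prime_two M)) (fun ρ ↦ hph ρ ρ.2)
  by_cases hM : M₀ + 1 ≤ M
  · -- `M ≥ M₀ + 1`: the socle is the lift of the `ℓ₀`-trivial class, visible by hypothesis
    have h1 : (2 : ℤ) ∣ ((2 ^ (M + 1) : ℕ) : ℤ) := by
      rw [pow_succ]; push_cast; exact Dvd.intro_left _ rfl
    obtain ⟨u, huS, hu0, huv, hsoc, hne, h2⟩ := exists_doorTrivial_lift_eq_heegnerSocle W hr0 hρ hTam hneg K hIQ hodd h3 hHe hsq1 hsq2 ℓ₀ v hℓ₀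
      hdK h2K hv hVIS Dt hopt hc β ι d₁ hy M₀ hdiv hndiv Wd hWd hrd hSel hbudget h4 hGZK M hM hdvd h1
    have hy2M : ((2 ^ (M + 1) : ℕ) : ℤ) • torsionH1OfDvd (W.baseChange K) hdvd (d₁.kolyvaginClass Nat.prime_two M) = 0 :=
      zsmul_galH1Torsion_eq_zero (W.baseChange K) _ _
    rcases zsmul_eq_zero_or_eq_socle _ hy2M (M - (M₀ + 1)) (by rw [hsoc]; exact hne) (by rw [hsoc]; exact h2) c htwo with h0 | hσ
    · exact h0
    · exfalso
      refine hvis M hM h1 u huS hu0 huv fun ρ hρ' ↦ ?_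
      rw [← hsoc, ← hσ]
      exact hph ρ hρ'
  · -- `M ≤ M₀`: `c_M(1) = κ_{2^M}(P₀) = 2^{M₀} • κ_{2^M}(Q₀) = 0`
    push Not at hM
    have hsqΔ : ¬ IsSquare ((NumberField.discr K : ℚ) * W.Δ) := by
      rwa [show -|W.Δ| = W.Δ by rw [abs_of_neg hneg, neg_neg]] at hsq1
    have htors1 : ∀ T : (W.baseChange (ringClassField K ι 1)).toAffine.Point, (2 : ℤ) • T = 0 → T = 0 := by
      intro T hT
      have h := GenusExact.torsionBy_two_ringClassField_eq_bot W hIQ ι one_ne_zero hρ2 hsqΔ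
      have hT' : T ∈ AddSubgroup.torsionBy (W.baseChange (ringClassField K ι 1)).toAffine.Point ((2 : ℕ) : ℤ) :=
        (Submodule.mem_torsionBy_iff _ T).mpr (by exact_mod_cast hT)
      rw [h] at hT'
      exact (AddSubgroup.mem_bot).mp hT'
    obtain ⟨P₀, -, hP₀⟩ := heegnerSystem_exists_isHeegnerPoint_map_eq_derivedPoint_one
      (heegnerPointOfConductor_one_galoisConj_holds (W.conductorNorm ℤ) W K) hIQ hHe d₁
    obtain ⟨Q, hQ⟩ := hdiv
    obtain ⟨Q₀, hQ₀⟩ := (McCallum1991.exists_pow_smul_eq_derivedPoint_one_iff hIQ d₁ (p := 2) htors1 hP₀ M₀).mp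
      ⟨Q, by simpa only [Nat.cast_pow, Nat.cast_ofNat] using hQ⟩
    have hQ₀' : ((2 ^ M₀ : ℕ) : ℤ) • Q₀ = P₀ := by simpa only [Nat.cast_pow, Nat.cast_ofNat] using hQ₀
    have hzero := kolyvaginClass_one_eq_zero_of_le W hIQ hodd hHe hsurj1 d₁ hP₀ (M := M) hQ₀' (by omega)
    rw [hzero, map_zero]
    exact zsmul_zero _

/-- **N2's (HL) REDUCED TO THE VISIBILITY OVER `ℚ` OF ONE LEVEL-2 CLASS** (N2's binders VERBATIM, ONE extra hypothesis OVER `ℚ`, conclusion = N2's (HL)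
VERBATIM): IF for every `M ≥ M₀ + 1` and every non-zero `ℓ₀`-trivial `u ∈ Sel₂(E)` the lift `ι_{1→M+1} u ∈ H¹(ℚ, E[2^{M+1}])` is NOT phantom over `ℚ` (not killed by
every `ρ ∈ Γ_{ℚ(E[2^{M+1}])}`), THEN (HL).  Over-`K` version + gk2-p4 g30's `ℚ ← K` descent of phantoms `RealVisible.forall_h1Eval_eq_zero_of_resTorsion` (index `2`,
`E(K)[2] = 0`) + `res ∘ ι = ι ∘ res`.  N2's own `ℓ₀`-VIS hypothesis is this statement AT LEVEL `4`; what STUB N2a must add is the level-stability of the phantom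
line `H¹(Gal(ℚ(E[2^k])/ℚ), E[2]) = H¹(Gal(ℚ(E[4])/ℚ), E[2])` (`k ≥ 2`).  BSD is NOT proved by this. [cite: LawsonWuthrich2016, §7.1, Lemma 3] [cite: McCallumLMS1991, §4 Lemma 4.6] -/
theorem heegnerLift_of_doorTrivial_nonPhantom_rat :
    ∀ (W : WeierstrassCurve ℚ) [W.IsElliptic] [W.IsGloballyMinimal] [NeZero (W.conductorNorm ℤ)],
      W.analyticRank = 0 → (∀ n : ℕ, 0 < n → W.HasSurjectiveModNGaloisRep ((2 : ℤ) ^ n)) → Odd W.tamagawaProduct → W.Δ < 0 →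
      ∀ (K : Type) [Field K] [NumberField K], IsImaginaryQuadratic K → Odd (NumberField.discr K) → NumberField.discr K ≠ -3 →
        SatisfiesHeegnerHypothesis (W.conductorNorm ℤ) K →
        ¬ IsSquare ((NumberField.discr K : ℚ) * -|W.Δ|) → ¬ IsSquare ((NumberField.discr K : ℚ) * (-(2 * |W.Δ|))) →
      ∀ (ℓ₀ : ℕ) (v : HeightOneSpectrum (𝓞 ℚ)), ℓ₀.Prime → NumberField.discr K = -(ℓ₀ : ℤ) →
        ((Ideal.span {(2 : ℤ)}).primesOver (𝓞 K)).ncard = 2 → ((ℓ₀ : ℕ) : 𝓞 ℚ) ∈ v.asIdeal →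
        (∀ c : galH1Torsion W 2, c ∈ W.selmerGroup 2 → c ∈ W.torsionLocalKer (v.adicCompletion ℚ) 2 →
            (∀ (h₁₂ : (2 : ℤ) ∣ ((2 ^ 2 : ℕ) : ℤ)), ∀ ρ ∈ torsionFixing W ((2 ^ 2 : ℕ) : ℤ),
              h1Eval W ((2 ^ 2 : ℕ) : ℤ) (torsionH1OfDvd W h₁₂ c) ρ = 0) → c = 0) →
      ∀ (Dt : ModularParametrizationData W (W.conductorNorm ℤ)),
        (∀ z ∈ Dt.L.lattice, ∃ w ∈ periodLattice Dt.f, z = (Dt.c : ℂ) * w) → Odd Dt.c →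
      ∀ (β : ℤ) (ι : K →+* ℂ) (d₁ : KolyvaginHeegnerData Dt β ι 1), ¬ IsOfFinAddOrder d₁.derivedPoint →
      ∀ (M₀ : ℕ), (∃ Q : (W.baseChange (ringClassField K ι 1)).toAffine.Point, ((2 ^ M₀ : ℕ) : ℤ) • Q = d₁.derivedPoint) →
        (¬ ∃ Q : (W.baseChange (ringClassField K ι 1)).toAffine.Point, ((2 ^ (M₀ + 1) : ℕ) : ℤ) • Q = d₁.derivedPoint) →
      ∀ (Wd : WeierstrassCurve ℚ) [Wd.IsElliptic] [Wd.IsGloballyMinimal],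
        (∃ C : WeierstrassCurve.VariableChange ℚ, C • W.quadraticTwist (NumberField.discr K : ℚ) = Wd) →
        Wd.analyticRank = 1 → Nat.card (Wd.selmerGroup 2) = 2 → padicValNat 2 Wd.tamagawaProduct ≤ 1 →
      Nat.card (W.selmerGroup 2) = 4 → MultPublishedInputsAtTwo →
      (∀ (M : ℕ), M₀ + 1 ≤ M → ∀ (h1 : (2 : ℤ) ∣ ((2 ^ (M + 1) : ℕ) : ℤ)), ∀ u ∈ W.selmerGroup 2, u ≠ 0 →
          u ∈ W.torsionLocalKer (v.adicCompletion ℚ) 2 →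
          ¬ (∀ ρ ∈ torsionFixing W ((2 ^ (M + 1) : ℕ) : ℤ), h1Eval W ((2 ^ (M + 1) : ℕ) : ℤ) (torsionH1OfDvd W h1 u) ρ = 0)) →
      (∀ (M : ℕ) (hdvd : ((2 ^ M : ℕ) : ℤ) ∣ ((2 ^ (M + 1) : ℕ) : ℤ)) (c : ℤ),
          (∀ ρ ∈ torsionFixing (W.baseChange K) ((2 ^ (M + 1) : ℕ) : ℤ), h1Eval (W.baseChange K) ((2 ^ (M + 1) : ℕ) : ℤ)
              (c • torsionH1OfDvd (W.baseChange K) hdvd (d₁.kolyvaginClass Nat.prime_two M)) ρ = 0) →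
          c • torsionH1OfDvd (W.baseChange K) hdvd (d₁.kolyvaginClass Nat.prime_two M) = 0) :=
  fun W _ _ _ hr0 hρ hTam hneg K _ _ hIQ hodd h3 hHe hsq1 hsq2 ℓ₀ v hℓ₀ hdK h2K hv hVIS Dt hopt hc β ι d₁ hy M₀ hdiv hndiv Wd _ _ hWd hrd hSel
      hbudget h4 hGZK hvisQ ↦
    heegnerLift_of_doorTrivial_nonPhantom W hr0 hρ hTam hneg K hIQ hodd h3 hHe hsq1 hsq2 ℓ₀ v hℓ₀ hdK h2K hv hVIS Dt hopt hc β ι d₁ hy M₀ hdiv hndiv Wd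
      hWd hrd hSel hbudget h4 hGZK fun M hM h1 u huS hu0 huv hphK ↦ by
        have hρ2 : W.HasSurjectiveModNGaloisRep 2 := by simpa using hρ 1 one_pos
        have hbotK : AddSubgroup.torsionBy (W.baseChange K).toAffine.Point (2 : ℤ) = ⊥ :=
          torsionBy_two_baseChange_eq_bot_of_hasSurjectiveModNGaloisRep_two_of_isImaginaryQuadratic W hρ2 K hIQ
        refine hvisQ M hM h1 u huS hu0 huv (RealVisible.forall_h1Eval_eq_zero_of_resTorsion W K hIQ.1 _
          (RealVisible.geomTorsion_eq_zero_of_forall_smul_eq W K hbotK) (torsionH1OfDvd W h1 u) fun τ hτ ↦ ?_)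
        rw [GenusExact.SelmerDescent.resTorsion_torsionH1OfDvd]
        exact hphK τ hτ

end HL

end Summit.BirchSwinnertonDyer.BirchSwinnertonDyer.Theorems.GenusExact.PlusDescent.SocleSelection

end
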